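import Mathlib
import HarnessLib

/-!
# ValiantsHypothesis / LacunarySymmetroid — crux `MatrixDescartes` (stmt-ValiantsHypothesis-18050, V1),
# line `Cruxes/MatrixDescartes/Lines/osculation_law.lean` («osculation-law»), stub `stub_recursion`, general position (ROUTE′):
# FINITELY MANY BAD PARAMETERS FOR A POLYNOMIAL PENCIL AGAINST A FIXED POLYNOMIAL

Service lemma for the arc-avoidance certificates (a1)/(a2) (val-lit-p7 g13's `…GPArcWitnessNodeOne/NodeTwo`; bus l.8280):
the companion of `OsculationGeneric.finite_setOf_not_isCoprime_C_mul_X_pow_add` for pencils of ANY degree in the parameter.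

For a fixed nonzero real polynomial `G` and a pencil `Q_a = ∑_{k ≤ n} C a ^ k * P k` (`P k ∈ ℝ[X]`, real parameter `a`):

* `finite_setOf_not_isCoprime_sum_C_pow_mul` — if at every complex root `z` of `G` some coefficient `P k` does not vanish, then
  `Q_a` is coprime to `G` for all but finitely many real `a` (a bad `a` is a root of the NONZERO complex polynomial
  `∑_k (P k)(z)·X^k` for one of the finitely many roots `z` of `G`).
* `…_of_isCoprime` — the same under the handier hypothesis `∃ k, IsCoprime (P k) G`.
* `finite_setOf_not_isCoprime_linear` / `…_quadratic` / `…_cubic` — the cases `n = 1, 2, 3` spelled out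
  (`P₀ + C a * P₁ (+ C a ^ 2 * P₂ (+ C a ^ 3 * P₃))`), hypothesis «one of the `P i` is coprime to `G`»; primed versions with `G` on
  the left; `…_linear_sub` with a shifted parameter `C (a − s)` (node 2: `α_i = C − σ_{j,i}`, bus l.8291).

Honest framing: one-variable polynomial algebra toward the OPEN stub `stub_recursion` (its density residue); nothing of the
summit is proved; `VP ≠ VNP` is NOT proved.  No definitions, no named facts.
-/

-- `Summit.ValiantsHypothesis.ValiantsHypothesis.…` is the tree's mandated single-conjunct layout (Sub = Summit).
set_option linter.dupNamespace false

noncomputable section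

namespace Summit.ValiantsHypothesis.ValiantsHypothesis.Theorems.LacunarySymmetroidMatrixDescartes

open Polynomial

namespace OsculationGeneric

/-! ### The coefficient polynomial at a complex point -/

/-- Evaluating the pencil `∑_k C a ^ k * P k` at a complex point `z` is evaluating the «coefficient polynomial at `z`»
`∑_k C ((P k)(z)) * X ^ k ∈ ℂ[X]` at the real parameter `a`. [folklore] -/
theorem aeval_sum_C_pow_mul {n : ℕ} (P : Fin (n + 1) → ℝ[X]) (a : ℝ) (z : ℂ) :
    aeval z (∑ k : Fin (n + 1), Polynomial.C a ^ (k : ℕ) * P k) =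
      aeval (a : ℂ) (∑ k : Fin (n + 1), Polynomial.C (aeval z (P k)) * X ^ (k : ℕ)) := by
  simp only [map_sum, map_mul, map_pow, aeval_C, aeval_X, Complex.coe_algebraMap, Algebra.algebraMap_self_apply]
  exact Finset.sum_congr rfl fun k _ => mul_comm _ _

/-- The coefficient polynomial at `z` is nonzero as soon as one coefficient `(P k)(z)` is. [folklore] -/
theorem sum_C_mul_X_pow_ne_zero {n : ℕ} (c : Fin (n + 1) → ℂ) (k : Fin (n + 1)) (hk : c k ≠ 0) :
    (∑ j : Fin (n + 1), Polynomial.C (c j) * X ^ (j : ℕ) : ℂ[X]) ≠ 0 := by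
  intro h0
  apply hk
  have hc := congr_arg (fun p : ℂ[X] => p.coeff (k : ℕ)) h0
  simp only [finsetSum_coeff, coeff_C_mul, coeff_X_pow, mul_ite, mul_one, mul_zero, coeff_zero] at hc
  simpa [Fin.val_eq_val, Finset.sum_ite_eq, Finset.sum_ite_eq'] using hc

/-! ### Finitely many bad parameters -/

/-- **Finitely many bad parameters (root-wise form).**  Let `G ≠ 0` be a real polynomial such that at every complex root `z`
of `G` some coefficient `P k` does not vanish.  Then `∑_k C a ^ k * P k` is coprime to `G` for all but finitely many real `a`:
a bad `a` is a (real) root of the nonzero complex polynomial `∑_k (P k)(z)·X^k` for one of the finitely many roots `z` of `G`.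
[folklore] -/
theorem finite_setOf_not_isCoprime_sum_C_pow_mul {n : ℕ} (G : ℝ[X]) (P : Fin (n + 1) → ℝ[X]) (hG : G ≠ 0)
    (hroot : ∀ z ∈ G.rootSet ℂ, ∃ k, aeval z (P k) ≠ 0) :
    {a : ℝ | ¬ IsCoprime (∑ k : Fin (n + 1), Polynomial.C a ^ (k : ℕ) * P k) G}.Finite := by
  classical
  -- the finitely many complex roots of `G`, and for each the finitely many roots of its coefficient polynomial
  set B : Set ℂ := ⋃ z ∈ G.rootSet ℂ,
    (∑ k : Fin (n + 1), Polynomial.C (aeval z (P k)) * X ^ (k : ℕ) : ℂ[X]).rootSet ℂ with hB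
  have hBfin : B.Finite := (G.rootSet_finite ℂ).biUnion fun z _ => rootSet_finite _ _
  refine (hBfin.preimage Complex.ofReal_injective.injOn).subset fun a ha => ?_
  -- a bad `a`: a common complex root `z` of the pencil member and `G`
  have ha' := mt (Polynomial.isCoprime_iff_aeval_ne_zero_of_isAlgClosed (k := ℝ) (K := ℂ)
    (p := ∑ k : Fin (n + 1), Polynomial.C a ^ (k : ℕ) * P k) (q := G)).2 ha
  push Not at ha'
  obtain ⟨z, hz1, hz2⟩ := ha'
  have hzroot : z ∈ G.rootSet ℂ := by
    rw [mem_rootSet]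
    exact ⟨hG, hz2⟩
  refine Set.mem_preimage.2 (Set.mem_biUnion hzroot ?_)
  obtain ⟨k, hk⟩ := hroot z hzroot
  rw [mem_rootSet]
  exact ⟨sum_C_mul_X_pow_ne_zero _ k hk, by rw [← aeval_sum_C_pow_mul, hz1]⟩

/-- **Finitely many bad parameters.**  If `G ≠ 0` and one of the coefficients `P k` is coprime to `G`, then
`∑_k C a ^ k * P k` is coprime to `G` for all but finitely many real `a`. [folklore] -/
theorem finite_setOf_not_isCoprime_sum_C_pow_mul_of_isCoprime {n : ℕ} (G : ℝ[X]) (P : Fin (n + 1) → ℝ[X])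
    (hG : G ≠ 0) (hcop : ∃ k, IsCoprime (P k) G) :
    {a : ℝ | ¬ IsCoprime (∑ k : Fin (n + 1), Polynomial.C a ^ (k : ℕ) * P k) G}.Finite := by
  obtain ⟨k, hkG⟩ := hcop
  refine finite_setOf_not_isCoprime_sum_C_pow_mul G P hG fun z hz => ⟨k, ?_⟩
  rw [mem_rootSet] at hz
  have h := (Polynomial.isCoprime_iff_aeval_ne_zero_of_isAlgClosed ℝ ℂ (P k) G).1 hkG z
  tauto

/-- The same, parameter sum written over `Finset.range (n+1)` with `P : ℕ → ℝ[X]`. [folklore] -/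
theorem finite_setOf_not_isCoprime_sum_range_C_pow_mul_of_isCoprime (G : ℝ[X]) (P : ℕ → ℝ[X]) (n : ℕ)
    (hG : G ≠ 0) (hcop : ∃ k ≤ n, IsCoprime (P k) G) :
    {a : ℝ | ¬ IsCoprime (∑ k ∈ Finset.range (n + 1), Polynomial.C a ^ k * P k) G}.Finite := by
  obtain ⟨k, hk, hkG⟩ := hcop
  have e : ∀ a : ℝ, ∑ k ∈ Finset.range (n + 1), Polynomial.C a ^ k * P k =
      ∑ k : Fin (n + 1), Polynomial.C a ^ (k : ℕ) * P k := fun a =>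
    (Fin.sum_univ_eq_sum_range (fun k => Polynomial.C a ^ k * P k) (n + 1)).symm
  simp_rw [e]
  exact finite_setOf_not_isCoprime_sum_C_pow_mul_of_isCoprime G (fun k : Fin (n + 1) => P k) hG
    ⟨⟨k, Nat.lt_succ_of_le hk⟩, hkG⟩

/-! ### Degrees one, two, three spelled out -/

/-- **Linear pencils.**  If `G ≠ 0` and `P₀` or `P₁` is coprime to `G`, then `P₀ + C a * P₁` is coprime to `G` for all
but finitely many real `a`. [folklore] -/
theorem finite_setOf_not_isCoprime_linear (G P₀ P₁ : ℝ[X]) (hG : G ≠ 0) (h : IsCoprime P₀ G ∨ IsCoprime P₁ G) :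
    {a : ℝ | ¬ IsCoprime (P₀ + Polynomial.C a * P₁) G}.Finite := by
  have e : ∀ a : ℝ, ∑ k : Fin (1 + 1), Polynomial.C a ^ (k : ℕ) * ![P₀, P₁] k = P₀ + Polynomial.C a * P₁ := fun a => by
    simp [Fin.sum_univ_two]
  simp_rw [← e]
  refine finite_setOf_not_isCoprime_sum_C_pow_mul_of_isCoprime G ![P₀, P₁] hG ?_
  rcases h with h | h
  · exact ⟨0, by simpa using h⟩
  · exact ⟨1, by simpa using h⟩

/-- **Linear pencils with a shifted parameter** (`α = a − s`, e.g. `α_i = C − σ_{j,i}` at node 2):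
`P₀ + C (a − s) * P₁` is coprime to `G` for all but finitely many real `a`. [folklore] -/
theorem finite_setOf_not_isCoprime_linear_sub (G P₀ P₁ : ℝ[X]) (s : ℝ) (hG : G ≠ 0)
    (h : IsCoprime P₀ G ∨ IsCoprime P₁ G) :
    {a : ℝ | ¬ IsCoprime (P₀ + Polynomial.C (a - s) * P₁) G}.Finite :=
  ((finite_setOf_not_isCoprime_linear G P₀ P₁ hG h).preimage (sub_left_injective (b := s)).injOn :)

/-- **Linear pencils, symmetric form** (`G` on the left of `IsCoprime`). [folklore] -/
theorem finite_setOf_not_isCoprime_linear' (G P₀ P₁ : ℝ[X]) (hG : G ≠ 0) (h : IsCoprime G P₀ ∨ IsCoprime G P₁) :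
    {a : ℝ | ¬ IsCoprime G (P₀ + Polynomial.C a * P₁)}.Finite := by
  have h' : IsCoprime P₀ G ∨ IsCoprime P₁ G := h.imp IsCoprime.symm IsCoprime.symm
  exact (finite_setOf_not_isCoprime_linear G P₀ P₁ hG h').subset fun a ha hc => ha hc.symm

/-- **Quadratic pencils.**  If `G ≠ 0` and one of `P₀, P₁, P₂` is coprime to `G`, then `P₀ + C a * P₁ + C a ^ 2 * P₂` is
coprime to `G` for all but finitely many real `a`. [folklore] -/
theorem finite_setOf_not_isCoprime_quadratic (G P₀ P₁ P₂ : ℝ[X]) (hG : G ≠ 0)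
    (h : IsCoprime P₀ G ∨ IsCoprime P₁ G ∨ IsCoprime P₂ G) :
    {a : ℝ | ¬ IsCoprime (P₀ + Polynomial.C a * P₁ + Polynomial.C a ^ 2 * P₂) G}.Finite := by
  have e : ∀ a : ℝ, ∑ k : Fin (2 + 1), Polynomial.C a ^ (k : ℕ) * ![P₀, P₁, P₂] k =
      P₀ + Polynomial.C a * P₁ + Polynomial.C a ^ 2 * P₂ := fun a => by
    simp [Fin.sum_univ_three]
  simp_rw [← e]
  refine finite_setOf_not_isCoprime_sum_C_pow_mul_of_isCoprime G ![P₀, P₁, P₂] hG ?_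
  rcases h with h | h | h
  · exact ⟨0, by simpa using h⟩
  · exact ⟨1, by simpa using h⟩
  · exact ⟨2, by simpa using h⟩

/-- **Cubic pencils.**  If `G ≠ 0` and one of `P₀, P₁, P₂, P₃` is coprime to `G`, then
`P₀ + C a * P₁ + C a ^ 2 * P₂ + C a ^ 3 * P₃` is coprime to `G` for all but finitely many real `a`. [folklore] -/
theorem finite_setOf_not_isCoprime_cubic (G P₀ P₁ P₂ P₃ : ℝ[X]) (hG : G ≠ 0)
    (h : IsCoprime P₀ G ∨ IsCoprime P₁ G ∨ IsCoprime P₂ G ∨ IsCoprime P₃ G) :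
    {a : ℝ | ¬ IsCoprime (P₀ + Polynomial.C a * P₁ + Polynomial.C a ^ 2 * P₂ + Polynomial.C a ^ 3 * P₃) G}.Finite := by
  have e : ∀ a : ℝ, ∑ k : Fin (3 + 1), Polynomial.C a ^ (k : ℕ) * ![P₀, P₁, P₂, P₃] k =
      P₀ + Polynomial.C a * P₁ + Polynomial.C a ^ 2 * P₂ + Polynomial.C a ^ 3 * P₃ := fun a => by
    simp [Fin.sum_univ_four]
  simp_rw [← e]
  refine finite_setOf_not_isCoprime_sum_C_pow_mul_of_isCoprime G ![P₀, P₁, P₂, P₃] hG ?_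
  rcases h with h | h | h | h
  · exact ⟨0, by simpa using h⟩
  · exact ⟨1, by simpa using h⟩
  · exact ⟨2, by simpa using h⟩
  · exact ⟨3, by simpa using h⟩

/-- **Quadratic pencils, symmetric form** (`G` on the left of `IsCoprime`). [folklore] -/
theorem finite_setOf_not_isCoprime_quadratic' (G P₀ P₁ P₂ : ℝ[X]) (hG : G ≠ 0)
    (h : IsCoprime G P₀ ∨ IsCoprime G P₁ ∨ IsCoprime G P₂) :
    {a : ℝ | ¬ IsCoprime G (P₀ + Polynomial.C a * P₁ + Polynomial.C a ^ 2 * P₂)}.Finite := by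
  have h' : IsCoprime P₀ G ∨ IsCoprime P₁ G ∨ IsCoprime P₂ G := by
    rcases h with h | h | h
    · exact Or.inl h.symm
    · exact Or.inr (Or.inl h.symm)
    · exact Or.inr (Or.inr h.symm)
  refine (finite_setOf_not_isCoprime_quadratic G P₀ P₁ P₂ hG h').subset fun a ha => ?_
  exact fun hc => ha hc.symm

end OsculationGeneric

end Summit.ValiantsHypothesis.ValiantsHypothesis.Theorems.LacunarySymmetroidMatrixDescartes

end
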